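import Summits.HodgeConjecture.CorCM.GaloisCertificateTimesTwo
import Mathlib.GroupTheory.SpecificGroups.Dihedral
import HarnessLib

/-!
# `D₁₆ × C₂` (order 64, `c = (r⁸, 1)`) is BAD: gen 22's `D₁₆` certificate lifted along the real quadratic factor

COR-CM (cell `pub-hodgecm2`), binder seat b04 (gen 30), count-neutral own lane «Galois-CM-type classification» (which Galois CM
fields `(G, c)` have ALL primitive CM types nondegenerate = GOOD, vs. a primitive degenerate type = BAD).  KERNEL ONLY: theorems;
no definition, no named fact, no `sorry`.  `HC_CM` is neither used nor claimed.

First use of `CorCM/GaloisCertificateTimesTwo.exists_simple_degenerate_prod_two_of_certificate`.  The dihedral group `D₁₆` of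
order `32` (Mathlib `DihedralGroup 16`, `c = r⁸`) is BAD by the balanced-set certificate of gen 20/22
(`CorCM/DihedralThirtyTwoDegenerateModel`: `T₀ = {r0,r1,r2,r3,r4,r6,r7,r13, sr0,sr1,sr2,sr3,sr4,sr7,sr13,sr14}`,
`D = {r0, r1, r12, sr4, sr5, sr9}`), while its index-two abelian subgroup `⟨r⟩ ≅ C₁₆` is a cyclic `2`-group, so the `× C₂` theorem of
`CorCM/GaloisIndexTwoTimesTwo` is silent (rightly: `D₄ × C₂` is GOOD, `D₈ × C₂` BAD).  Here: the annihilator `b = 𝟙_D − 𝟙_{cD}` of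
`T₀`, the right translate `T₀·r` (which is no left translate of `T₀` — `decide`), and the lifted type `T₀ × {1} ⊔ (T₀ r) × {t}` give

THEOREM (**`exists_simple_degenerate_dihedral_sixteen_times_two`**): `Gal(K/ℚ) ≅ D₁₆ × C₂` with complex conjugation `(r⁸, 1)` ⟹ a
SIMPLE DEGENERATE abelian variety of dimension `32` with CM by `K` (rational `(p,p)` class outside the divisor ring on some power).
(The other central involutions `(1, t)`, `(r⁸, t)` are complemented: `⟨c⟩ × D₁₆` is BAD by gen 19's capstone.)  This settles the
row «`D_{2^{k+1}} × C₂`, `k = 4`» of the gen-30 classification table; `SD₃₂ × C₂`, `M₃₂ × C₂` go the same way from gen 22's table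
models.

## References

* [Kubota1965] T. Kubota, *On the field extension by complex multiplication*, Trans. AMS 118 (1965), §2, §4 Lemma 2.
* [Shimura1998] G. Shimura, *Abelian Varieties with Complex Multiplication and Modular Functions*, §6.2 Thm. 3, §8.2 Prop. 26.
* [Gordon1999HodgeAVSurvey] B. B. Gordon, *A survey of the Hodge conjecture for abelian varieties*, Thm. 6.4, §9.3.
-/

noncomputable section

open CategoryTheory CategoryTheory.Limits NumberField DihedralGroup
open scoped BigOperators

namespace Summit.HodgeConjecture.CorCM.GaloisModels

open Literature.NumberTheory.ComplexMultiplication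
open Literature.AlgebraicGeometry.Motives (AbelianVariety CMType)
open Literature.AlgebraicGeometry.HodgeTheory
open Literature.AlgebraicGeometry.ComplexMultiplication (IsCMTypeRealisation)
open Literature.AlgebraicGeometry.Pohlmann1968
open Literature.Barriers.HodgeConjecture (divisorClassesSpan)

variable {K : Type} [Field K] [NumberField K] [IsCMField K] [IsGalois ℚ K]

/-- **`D₁₆ × C₂` (`c = (r⁸, 1)`) is BAD**: a simple DEGENERATE abelian variety of dimension `32` with CM by `K`, from gen 22's `D₁₆`
certificate lifted by `exists_simple_degenerate_prod_two_of_certificate` with `w = r`.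
[cite: Kubota1965, §2 and §4 Lemma 2] [cite: Shimura1998, §6.2 Thm. 3 and §8.2 Prop. 26] [cite: Gordon1999HodgeAVSurvey, Thm. 6.4 and §9.3] -/
theorem exists_simple_degenerate_dihedral_sixteen_times_two (e : (K ≃ₐ[ℚ] K) ≃* DihedralGroup 16 × Multiplicative (ZMod 2))
    (hc : e ((IsCMField.complexConj K).restrictScalars ℚ) = (r 8, 1)) :
    ∃ (Φ : CMType K) (φ₀ : K →+* ℂ) (X : AbelianVariety ℂ) (ι : 𝓞 K →+* End X)
      (ϑ : K →+* Module.End ℂ (complexBetti X.X 1)),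
      IsPrimitive (ℂ ≃+* ℂ) Φ.1 φ₀ ∧ ¬ IsNondegenerate Φ ∧ IsCMTypeRealisation Φ X ι ϑ ∧ X.IsSimple ∧ X.dim = 32 ∧
      ∃ m p : ℕ, ∃ y : complexBetti (⨁ fun _ : Fin m => X).X (2 * p), IsRationalClass y ∧
        IsOfHodgeType (⨁ fun _ : Fin m => X).dim (⨁ fun _ : Fin m => X).X (2 * p) p p y ∧
        y ∉ divisorClassesSpan (⨁ fun _ : Fin m => X).X (⨁ fun _ : Fin m => X).dim p := by
  have h := exists_simple_degenerate_prod_two_of_certificate e (r 8) hc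
    {r 0, r 1, r 2, r 3, r 4, r 6, r 7, r 13, sr 0, sr 1, sr 2, sr 3, sr 4, sr 7, sr 13, sr 14} (by decide) (by decide)
    (fun y => (if y ∈ ({r 0, r 1, r 12, sr 4, sr 5, sr 9} : Finset (DihedralGroup 16)) then (1 : ℤ) else 0) -
      (if r 8 * y ∈ ({r 0, r 1, r 12, sr 4, sr 5, sr 9} : Finset (DihedralGroup 16)) then (1 : ℤ) else 0))
    (by decide) (by decide) ⟨r 0, by decide⟩ (r 1) (by decide)
  rwa [DihedralGroup.card] at h

end Summit.HodgeConjecture.CorCM.GaloisModels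

end
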